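import Mathlib
import Summits.ValiantsHypothesis.ValiantsHypothesis.Theses.FermionizationDimension
import Literature.Computability.AlgebraicComplexity.ValiantClassesProofs
import Literature.Computability.AlgebraicComplexity.ValiantConjectureEquivProofs
import Summits.ValiantsHypothesis.ValiantsHypothesis.Theorems.DetqpThesis.Negative.Variants
import Summits.ValiantsHypothesis.ValiantsHypothesis.Theorems.ClassTransfer.Negative.OddPowFree
import Summits.ValiantsHypothesis.ValiantsHypothesis.Theorems.ClassTransfer.Negative.CyclicBlockSums

/-!
# Crux `ClassTransfer` (stmt-ValiantsHypothesis-7287): the EVEN-CYCLE DETERMINANT is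
# permanent-hard — `D^even ∈ VP ⇒ VP = VNP`

Lead prover of line `registered` (= `Cruxes/ClassTransfer/Lines/birth.lean`), negative side.
The crux's "why it might fail" names three suspect VP class-function families whose commutative
twisting dimension would be large: `sgn · t^{c₂}`, the 2-cycle-free determinant `D₂`, and
`D^even = Σ_{all cycles even} sgn x^σ`.  The first two are permanent-hard by the two-block
substitution of `Negative/FalsifierPerHard.lean`; this file settles the third:

**`per_m` is a projection of `D^even_{3m}`** (`isProjection_perPoly_evenCycleDet`, for every
`m` whose signed all-even count `E_m = Σ_{δ ∈ S_m, all cycles even} sgn δ` is nonzero — every even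
`m`, `sum_sign_mul_indicator_oddPowFree_ne_zero`): substitute the block-CYCLIC matrix
`L → M → R → L` with blocks `X`, `κJ`, `κJ`.  Only cyclic block maps `(k, i) ↦ (k+1, α_k i)`
survive (`sum_perm_blockCyclic`); their cycles are those of `δ = α₂α₁α₀` with lengths tripled,
so "all cycles even" transfers (`oddPowFree_blockCyclic_three_iff`, in the power-only form
`∀ x j, σ^{2j+1} x ≠ x`), and `sgn = sgn δ` (the block rotation is even); re-coordinatising
`α ↦ (α₀, α₁, δ)` (`sum_fin_three_perm_eq`) the sum collapses to `κ^{2m} · m! · E_m · per_m(X)`,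
and `κ` normalises the constant.  On paper: `D^even([[0,0,J],[B,0,0],[0,J,0]]) = m! E_m per_m(B)`,
`E_{2k} = -(2k-1)!!(2k-3)!!` (verified for `m ≤ 4` in the lead's `work/compute/`).

Consequences: `isPProjection_perPoly_evenCycleDet` (sizes `3 · 2⌈m/2⌉`, through
`per_m ≤ per_{m+1}` for odd `m`), `VP_eq_VNP_of_isVPFamily_evenCycleDet`,
`not_isVPFamily_evenCycleDet_of_valiantsHypothesis`.  With `FalsifierPerHard.lean`: **every
falsifier family recorded for this crux is a `VP` family only if `VP = VNP`** — none can separate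
`ClassTransfer` from the summit.  No definitions (the all-even weight is inlined, classically
decided). [folklore]
-/

set_option linter.dupNamespace false

noncomputable section

namespace Summit.ValiantsHypothesis.ValiantsHypothesis.Theorems.ClassTransfer.Negative

open Equiv Finset

/-- Re-coordinatising a triple of block maps by (first map, second map, composite).
[folklore] -/
theorem sum_fin_three_perm_eq {ι : Type*} [Fintype ι] [DecidableEq ι] {S : Type*}
    [AddCommMonoid S] (G : Perm ι → Perm ι → S) :
    ∑ α : Fin 3 → Perm ι, G (α 0) (α 2 * α 1 * α 0) =
      ∑ a : Perm ι, ∑ _b : Perm ι, ∑ δ : Perm ι, G a δ := by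
  classical
  -- the bijection `α ↦ (α 0, α 1, α 2 α 1 α 0)`
  let Ψ : (Fin 3 → Perm ι) ≃ Perm ι × Perm ι × Perm ι :=
    { toFun := fun α => (α 0, α 1, α 2 * α 1 * α 0)
      invFun := fun p => ![p.1, p.2.1, p.2.2 * (p.1)⁻¹ * (p.2.1)⁻¹]
      left_inv := by
        intro α
        funext k
        have hk3 : ∀ k' : Fin 3, k' = 0 ∨ k' = 1 ∨ k' = 2 := by decide
        rcases hk3 k with rfl | rfl | rfl
        · simp
        · simp
        · simp only [Matrix.cons_val]
          group
      right_inv := by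
        rintro ⟨a, b, δ⟩
        refine Prod.ext ?_ (Prod.ext ?_ ?_)
        · simp
        · simp
        · simp only [Matrix.cons_val]
          group }
  rw [Fintype.sum_equiv Ψ (fun α => G (α 0) (α 2 * α 1 * α 0)) (fun p => G p.1 p.2.2)
    (fun α => rfl)]
  rw [Fintype.sum_prod_type]
  refine Finset.sum_congr rfl fun a _ => ?_
  rw [Fintype.sum_prod_type]

open Classical in
/-- **`per_m` is a projection of the even-cycle determinant at triple size**,
`D^even_n = Σ_{σ ∈ S_n, all cycles even} sgn(σ) x^σ` (all cycles even ⟺ no odd power of `σ`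
fixes a point), provided the signed count `E_m = Σ_{δ ∈ S_m, all cycles even} sgn δ` is nonzero
(true for even `m`, `sum_sign_mul_indicator_oddPowFree_ne_zero`).  Substitute the block-cyclic
matrix `L → M → R → L` with blocks `X`, `κJ`, `κJ`: only cyclic block maps
`(k, i) ↦ (k+1, α_k i)` survive (`sum_perm_blockCyclic`), their cycles are those of
`δ = α₂α₁α₀` tripled (`oddPowFree_blockCyclic_three_iff`) and `sgn = sgn α₀ sgn α₁ sgn α₂ = sgn δ`
(the block rotation is even), so summing over `α₁` (i.e. over `δ`) and `α₂` leaves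
`κ^{2m} · m! · E_m · per_m(X)`. [folklore] -/
theorem isProjection_perPoly_evenCycleDet (m : ℕ) (hm : 0 < m)
    (hE0 : ∑ δ : Perm (Fin m), ((Perm.sign δ : ℤ) : ℂ) *
      (if (∀ (x : Fin m) (j : ℕ), (δ ^ (2 * j + 1)) x ≠ x) then (1 : ℂ) else 0) ≠ 0) :
    Literature.Computability.AlgebraicComplexity.IsProjection
      (Literature.Computability.AlgebraicComplexity.perPoly (Fin m) ℂ)
      (∑ σ : Equiv.Perm (Fin (3 * m)),
        MvPolynomial.C (((Equiv.Perm.sign σ : ℤ) : ℂ) *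
            (if (∀ (x : Fin (3 * m)) (j : ℕ), (σ ^ (2 * j + 1)) x ≠ x) then (1 : ℂ) else 0)) *
          ∏ i : Fin (3 * m), MvPolynomial.X (σ i, i)) := by
  -- the constants
  set D : ℂ := ∑ δ : Perm (Fin m), ((Perm.sign δ : ℤ) : ℂ) *
      (if (∀ (x : Fin m) (j : ℕ), (δ ^ (2 * j + 1)) x ≠ x) then (1 : ℂ) else 0) with hD
  have hfact : ((Nat.factorial m : ℕ) : ℂ) ≠ 0 := Nat.cast_ne_zero.2 (Nat.factorial_ne_zero m)
  obtain ⟨κ, hκ⟩ : ∃ κ : ℂ, κ ^ (2 * m) = (((Nat.factorial m : ℕ) : ℂ) * D)⁻¹ :=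
    IsAlgClosed.exists_pow_nat_eq _ (by omega)
  -- block coordinates
  set e : Fin 3 × Fin m ≃ Fin (3 * m) := finProdFinEquiv with he
  set E' : (Fin 3 × Fin m) → (Fin 3 × Fin m) → MvPolynomial (Fin m × Fin m) ℂ := fun r c =>
    if r.1 = c.1 + 1 then (if c.1 = 0 then MvPolynomial.X (r.2, c.2) else MvPolynomial.C κ) else 0
    with hE'
  have hEoff : ∀ (k k' : Fin 3) (i i' : Fin m), k' ≠ k + 1 → E' (k', i') (k, i) = 0 := by
    intro k k' i i' hk; simp [hE', hk]
  have hEon : ∀ (k : Fin 3) (i i' : Fin m), E' (k + 1, i') (k, i) =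
      if k = 0 then MvPolynomial.X (i', i) else MvPolynomial.C κ := by
    intro k i i'; simp [hE']
  set a : Fin (3 * m) × Fin (3 * m) → MvPolynomial (Fin m × Fin m) ℂ :=
    fun rc => E' (e.symm rc.1) (e.symm rc.2) with ha
  refine ⟨a, ?_, ?_⟩
  · -- every substituted entry is a variable or a constant
    rintro ⟨r, c⟩
    simp only [ha, hE']
    split_ifs
    · exact Or.inl ⟨_, rfl⟩
    · exact Or.inr ⟨κ, rfl⟩
    · exact Or.inr ⟨0, by rw [map_zero]⟩
  · symm
    rw [map_sum]
    have hterm : ∀ σ : Perm (Fin (3 * m)),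
        MvPolynomial.aeval a (MvPolynomial.C (((Equiv.Perm.sign σ : ℤ) : ℂ) *
            (if (∀ (x : Fin (3 * m)) (j : ℕ), (σ ^ (2 * j + 1)) x ≠ x) then (1 : ℂ) else 0)) *
          ∏ i : Fin (3 * m), MvPolynomial.X (σ i, i)) =
        MvPolynomial.C (((Equiv.Perm.sign σ : ℤ) : ℂ) *
            (if (∀ (x : Fin (3 * m)) (j : ℕ), (σ ^ (2 * j + 1)) x ≠ x) then (1 : ℂ) else 0)) *
          ∏ i : Fin (3 * m), a (σ i, i) := by
      intro σ
      rw [map_mul, map_prod, MvPolynomial.aeval_C, MvPolynomial.algebraMap_eq]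
      simp only [MvPolynomial.aeval_X]
    rw [Finset.sum_congr rfl fun σ _ => hterm σ]
    -- transport to block coordinates
    rw [← Fintype.sum_equiv e.permCongr
      (fun σ' => MvPolynomial.C (((Equiv.Perm.sign (e.permCongr σ') : ℤ) : ℂ) *
          (if (∀ (x : Fin (3 * m)) (j : ℕ), ((e.permCongr σ') ^ (2 * j + 1)) x ≠ x) then (1 : ℂ)
            else 0)) *
        ∏ y : Fin 3 × Fin m, E' (σ' y) y) _ (fun σ' => ?_)]
    swap
    · congr 1
      rw [← Fintype.prod_equiv e (fun y => a ((e.permCongr σ') (e y), e y)) _ (fun _ => rfl)]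
      refine Fintype.prod_congr _ _ fun y => ?_
      simp [ha, Equiv.permCongr_apply]
    -- only cyclic block maps survive
    rw [sum_perm_blockCyclic _ E' hEoff]
    -- evaluate each surviving term
    have hval : ∀ α : Fin 3 → Perm (Fin m),
        MvPolynomial.C (((Equiv.Perm.sign (e.permCongr ((Equiv.prodCongrRight α).trans
            (Equiv.prodCongrLeft fun _ : Fin m => Equiv.addRight (1 : Fin 3)))) : ℤ) : ℂ) *
          (if (∀ (x : Fin (3 * m)) (j : ℕ), ((e.permCongr ((Equiv.prodCongrRight α).trans
            (Equiv.prodCongrLeft fun _ : Fin m => Equiv.addRight (1 : Fin 3)))) ^ (2 * j + 1)) x ≠ x)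
            then (1 : ℂ) else 0)) *
          ∏ k : Fin 3, ∏ i : Fin m, E' (k + 1, α k i) (k, i) =
        (MvPolynomial.C (κ ^ (2 * m)) * ∏ i : Fin m, MvPolynomial.X (α 0 i, i)) *
          MvPolynomial.C (((Perm.sign (α 2 * α 1 * α 0) : ℤ) : ℂ) *
            (if (∀ (x : Fin m) (j : ℕ), ((α 2 * α 1 * α 0) ^ (2 * j + 1)) x ≠ x) then (1 : ℂ)
              else 0)) := by
      intro α
      -- the sign
      have hsgn : Perm.sign (e.permCongr ((Equiv.prodCongrRight α).trans
          (Equiv.prodCongrLeft fun _ : Fin m => Equiv.addRight (1 : Fin 3)))) =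
          Perm.sign (α 2 * α 1 * α 0) := by
        rw [Perm.sign_permCongr, sign_blockCyclic_three]
      rw [hsgn]
      -- the indicator
      rw [if_congr ((oddPowFree_permCongr_iff e _).trans (oddPowFree_blockCyclic_three_iff α))
        rfl rfl]
      -- the entries
      simp only [hEon, Fin.prod_univ_three]
      have h1 : ((1 : Fin 3) = 0) = False := by decide
      have h2 : ((2 : Fin 3) = 0) = False := by decide
      simp only [if_true, h1, h2, if_false, Finset.prod_const, Finset.card_univ,
        Fintype.card_fin]
      rw [map_pow]
      ring
    rw [Finset.sum_congr rfl fun α _ => hval α]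
    -- regroup: `α ↦ (α 0, α 1, α 2 α 1 α 0)`
    rw [sum_fin_three_perm_eq (fun a δ => (MvPolynomial.C (κ ^ (2 * m)) *
        ∏ i : Fin m, MvPolynomial.X (a i, i)) * MvPolynomial.C (((Perm.sign δ : ℤ) : ℂ) *
          (if (∀ (x : Fin m) (j : ℕ), (δ ^ (2 * j + 1)) x ≠ x) then (1 : ℂ) else 0)))]
    have hα : ∀ a : Perm (Fin m),
        ∑ _b : Perm (Fin m), ∑ δ : Perm (Fin m), (MvPolynomial.C (κ ^ (2 * m)) *
          ∏ i : Fin m, MvPolynomial.X (a i, i)) * MvPolynomial.C (((Perm.sign δ : ℤ) : ℂ) *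
            (if (∀ (x : Fin m) (j : ℕ), (δ ^ (2 * j + 1)) x ≠ x) then (1 : ℂ) else 0)) =
          ∏ i : Fin m, (MvPolynomial.X (a i, i) : MvPolynomial (Fin m × Fin m) ℂ) := by
      intro a
      rw [Finset.sum_const, Finset.card_univ, Fintype.card_perm, Fintype.card_fin,
        ← Finset.mul_sum, ← map_sum, ← hD, nsmul_eq_mul, ← MvPolynomial.C_eq_coe_nat]
      have hone : ((Nat.factorial m : ℕ) : ℂ) * (κ ^ (2 * m) * D) = 1 := by
        rw [hκ]
        field_simp
      rw [mul_comm (MvPolynomial.C (κ ^ (2 * m))) _, mul_assoc, ← map_mul, ← mul_assoc,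
        mul_comm (MvPolynomial.C ((Nat.factorial m : ℕ) : ℂ)) _, mul_assoc, ← map_mul, hone,
        map_one, mul_one]
    rw [Finset.sum_congr rfl fun a _ => hα a]
    simp [Literature.Computability.AlgebraicComplexity.perPoly, Matrix.permanent,
      Matrix.mvPolynomialX]


open Classical in
/-- The degenerate size: `per_0 = 1 = D^even_0`. [folklore] -/
theorem isProjection_perPoly_evenCycleDet_zero :
    Literature.Computability.AlgebraicComplexity.IsProjection
      (Literature.Computability.AlgebraicComplexity.perPoly (Fin 0) ℂ)
      (∑ σ : Equiv.Perm (Fin 0),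
        MvPolynomial.C (((Equiv.Perm.sign σ : ℤ) : ℂ) *
            (if (∀ (x : Fin 0) (j : ℕ), (σ ^ (2 * j + 1)) x ≠ x) then (1 : ℂ) else 0)) *
          ∏ i : Fin 0, MvPolynomial.X (σ i, i)) := by
  refine ⟨fun _ => 0, fun _ => Or.inr ⟨0, (map_zero _).symm⟩, ?_⟩
  have h1 : Literature.Computability.AlgebraicComplexity.perPoly (Fin 0) ℂ = 1 := by
    simp [Literature.Computability.AlgebraicComplexity.perPoly, Matrix.permanent_isEmpty]
  rw [h1, map_sum]
  simp

open Classical in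
/-- **The permanent family is a p-projection of the even-cycle determinant family**
`D^even_n = Σ_{σ ∈ S_n, all cycles even} sgn(σ) x^σ` (sizes `t(m) = 3 · 2⌈m/2⌉`: triple an even
number of points, passing through `per_m ≤ per_{m+1}` for odd `m`). [folklore] -/
theorem isPProjection_perPoly_evenCycleDet :
    Literature.Computability.AlgebraicComplexity.IsPProjection
      (fun m => Literature.Computability.AlgebraicComplexity.perPoly (Fin m) ℂ)
      (fun n => ∑ σ : Equiv.Perm (Fin n),
        MvPolynomial.C (((Equiv.Perm.sign σ : ℤ) : ℂ) *
            (if (∀ (x : Fin n) (j : ℕ), (σ ^ (2 * j + 1)) x ≠ x) then (1 : ℂ) else 0)) *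
          ∏ i : Fin n, MvPolynomial.X (σ i, i)) := by
  refine ⟨fun m => 3 * (2 * ((m + 1) / 2)),
    (Literature.Computability.AlgebraicComplexity.IsPBounded.iff_exists_le_mul_succ_pow _).2
      ⟨6, 1, fun n => by rw [pow_one]; omega⟩, fun m => ?_⟩
  dsimp only
  obtain ⟨k, rfl | rfl⟩ := Nat.even_or_odd' m
  · rw [show (2 * k + 1) / 2 = k by omega]
    rcases Nat.eq_zero_or_pos k with rfl | hk
    · exact isProjection_perPoly_evenCycleDet_zero
    · exact isProjection_perPoly_evenCycleDet (2 * k) (by omega)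
        (sum_sign_mul_indicator_oddPowFree_ne_zero k)
  · rw [show (2 * k + 1 + 1) / 2 = k + 1 by omega]
    refine Literature.Computability.AlgebraicComplexity.IsProjection.trans_holds
      (Summit.ValiantsHypothesis.Theorems.DetqpThesis.Negative.isProjection_perPoly_succ ℂ (2 * k + 1))
      ?_
    exact isProjection_perPoly_evenCycleDet (2 * (k + 1)) (by omega)
      (sum_sign_mul_indicator_oddPowFree_ne_zero (k + 1))

open Classical in
/-- **`D^even ∈ VP ⇒ VP = VNP`**: the even-cycle determinant — the third family named in the
crux's "why it might fail" — is permanent-hard as well. [folklore] -/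
theorem VP_eq_VNP_of_isVPFamily_evenCycleDet
    (hVP : Literature.Computability.AlgebraicComplexity.IsVPFamily
      (fun n => ∑ σ : Equiv.Perm (Fin n),
        MvPolynomial.C (((Equiv.Perm.sign σ : ℤ) : ℂ) *
            (if (∀ (x : Fin n) (j : ℕ), (σ ^ (2 * j + 1)) x ≠ x) then (1 : ℂ) else 0)) *
          ∏ i : Fin n, MvPolynomial.X (σ i, i))) :
    Literature.Computability.AlgebraicComplexity.VP ℂ =
      Literature.Computability.AlgebraicComplexity.VNP ℂ :=
  Literature.Computability.AlgebraicComplexity.isPComputable_perPoly_complex_iff.1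
    (Literature.Computability.AlgebraicComplexity.IsVPFamily.of_isPProjection_holds
      (Literature.Computability.AlgebraicComplexity.isPFamily_perPoly_holds (k := ℂ))
      isPProjection_perPoly_evenCycleDet hVP).2

open Classical in
/-- Under Valiant's hypothesis the even-cycle determinant family is not in `VP`. [folklore] -/
theorem not_isVPFamily_evenCycleDet_of_valiantsHypothesis (hVH : _root_.ValiantsHypothesis) :
    ¬ Literature.Computability.AlgebraicComplexity.IsVPFamily
      (fun n => ∑ σ : Equiv.Perm (Fin n),
        MvPolynomial.C (((Equiv.Perm.sign σ : ℤ) : ℂ) *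
            (if (∀ (x : Fin n) (j : ℕ), (σ ^ (2 * j + 1)) x ≠ x) then (1 : ℂ) else 0)) *
          ∏ i : Fin n, MvPolynomial.X (σ i, i)) :=
  fun hVP => hVH (VP_eq_VNP_of_isVPFamily_evenCycleDet hVP)

end Summit.ValiantsHypothesis.ValiantsHypothesis.Theorems.ClassTransfer.Negative
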